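import Summits.QuantumFields.YangMills.Theorems.BalabanUVNodesN12Prop1AssembledOfGaugeLetterAtToleranceLocOfChartLetterN
import Literature.MathematicalPhysics.QuantumFieldTheory.Balaban1983to89.B15Prop1GaugeLetterSocketOfForestPackage

/-!
# BalabanUVNodes ∕ N12 — PROPOSITION 1 [IV] AT PRINT'S (1.74) OBJECT, THE FULL ASSEMBLY WITH THE GAUGE LETTER DISCHARGED BY NAME («(vi)»): from the R-explicit (J0′) letter at a
# reference guard, dag-n12-w3's rooted tower-forest package of `𝐁_k(Z)`, dag-n12-w6's forest-gauge producer with a GRADED ROOT-FREE PLAQUETTE LETTER at the minimiser and a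
# ROOT-TRANSPORTER LETTER (both linear in the guard), dag-n12-w4's chart letter by name, the [15] Theorem-1 letter and the instance geometry

Cell `pub-ymgap` (HUMAN RULINGS D-0062 ∕ D-0149 ∕ D-0154), WIDTH SEAT `pub-ymgap-dag-n12-w5` g5 (node N12 = [B15]; key K1⁹ `stmt-QuantumFields-27364`, `--kind proof --supports …
--as helper`; count-neutral).  dag-n12-d g18's successor trigger (t92) («a (σ)_N-discharging endpoint ⇒ n12-w5 (vi) ⇒ 12Q¹⁴»).  THEOREMS ONLY (0 `def`, 0 `instance`, 0 `sorry`); composition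
BY NAME of this seat's (v) `N12Prop1AssembledOfGaugeLetterAtToleranceLocOfChartLetterN.…_ofGaugeLetterNAtTolerance_ofChartLetterN_ofCoercive` (p639701) and
`B15Prop1GaugeLetterSocketOfForestPackage.hσN_of_forestPackage_linear` (over dag-n12-w6 g2's `exists_gaugeLetterLoc_atRecord_of_forestPackage`, p640962).

WHY.  (v) displays the localised gauge letter `hσN` as ONE ∀δ∃e hypothesis per instance.  dag-n12-w6 g2's assembled producer builds that letter from gauge-invariant ∕ datum-side
inputs; with the two displayed letters read LINEAR in the guard, `hσN` becomes a theorem (`hσN_of_forestPackage_linear`).  THIS FILE is (v) with the swap executed: the binder `hσN`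
is REPLACED by, per instance, the forest package (`path root hF2 hwalk hpkg hcov` — dag-n12-w3's `exists_towerForest_rooted_Bj` ∕ `N12RootedForest` by shape), budgets (`ℓs ℓb ℓ ℓT`
with `hℓs hcapS hcapB hNcap`), the `N i`-geometry (`hGN` (gN1) at the region box, `hN1` (gN2)), the reference guard and moduli (`e₀ cP cT cG`), the GRADED ROOT-FREE PLAQUETTE LETTER
at the minimiser `hP` on `S i` with `hSΩ` ((1.7) ∕ [15] Thm 1 — the K0 door's output, linear in the guard) and the ROOT-TRANSPORTER LETTER `hT` ([15] (16)–(18); dag-n12-w3's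
`rootTransporter_Bj` road, linear in the guard).  After it the K1 knit's N12 Prop-1 row asks no gauge letter: (J0′)@`eR₀`, forest package + budgets + `N`-geometry + `hNpos`, the two
linear letters, `hΩw`, `h15T`, geometry, signs.

HONEST FRAMING.  Composition by name; the plaquette letter at the minimiser, the transporter letter, the forest package, (J0′), the [15] Theorem-1 letter and the geometry stay
DISPLAYED (their inhabitation is the K0 door's ∕ dag-n12-w3's ∕ dag-n12-w1's business); per the lane owner's LOCATED-GEOM v3 the bondwise road serves instances with simply-connected,
normalisable `Ω₁(Z_i)`; nothing of Bałaban's is asserted; count-neutral; N12 NOT discharged; K1⁹ NOT closed; counts unmoved; one finite 𝕋⁴ programme at fixed `ε = L^{-K}` — R4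
closes only the conditional rung `BalabanLadder.UV`; no summit statement is proved here and NOT the Yang–Mills mass gap (Clay); nothing continuum ∕ ℝ⁴ ∕ OS.

References: [Balaban1989LargeFieldI] CMP 122 (1989) 175–202, (1.74) p.192, Prop. 1 (1.77)–(1.78) p.194, (1.79) p.195; [Balaban1989LargeFieldII] CMP 122 (1989) 355–392, p.357,
(1.7)–(1.9) p.358, (1.12)–(1.13) p.359; [Balaban1985Variational] CMP 102 (1985) 277–309, (2)–(4) p.278, Thm 1 (8) p.279, (16)–(18) p.280, Prop. 9 (190) p.309; [Balaban1985RegularSpaces]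
CMP 98 (1985), (1.7) p.77, (1.19) p.79; [Balaban1988Convergent] CMP 119 (1988) 243–285, (2.2) p.255, (2.11)–(2.14) pp.256–257, (2.16) p.257.
-/

noncomputable section

open Set Finset Metric Filter
open scoped BigOperators Matrix RealInnerProductSpace Real InnerProductSpace Topology Matrix.Norms.L2Operator

namespace Summit.QuantumFields.YangMills.BalabanUVNodes.N12Prop1AssembledOfForestPackageLocOfChartLetterN

open Literature.MathematicalPhysics.QuantumFieldTheory.Balaban1983to89
open T4Continuum B15DeterminingSets GaugeField B16Sect1Backgrounds B15Prop1Carrier B8Eq17ClassAkV1 BlockAveraging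
open B15Prop1SliceTaylorCalculus
open B15Prop1ChartCalculusSU2 (E3)
open T4CubeChartGnomonic (SU2)
open B15Prop1ChartSU2 (su2Chart)
open B15Prop1SliceCoordinates (GaugeSlice ιA freeBonds)
open B15Prop1AnalyticExtClause (cplxVec anExt)
open T4AdjointCovarianceUnitary (lieSU)
open T4AxialGaugeSmallField (castSite boxPlaqs boxBonds)
open B6BondElimination (unitVec)
open B6TreeGaugePoincare (curl)
open B16Eq18Proof (box mem_box)
open B15Extension193 (extend)
open B15ShellGauge193 (shellGauge)
open B14.Eq213MaximalDomains (side)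
open B14.Eq213DetSet B14.Eq216Concrete B15Sect1Instances B15Eq177GaugeInvariance B15Eq177ValueInvariance B15Eq177ValueInvarianceCoDiv B16Sect1Wilson
open B14.Eq22Determines (blockIter IsBlockUnion)
open B5Eq118OneStroke (iterBlockOf)
open Literature.MathematicalPhysics.QuantumFieldTheory.BalabanImbrieJaffe1984to88.BIJ85Eq453GaugeField
open Node00 (expChart msChart constrCard)
open B15Prop1GaugeLetterSocketOfForestPackage (hσN_of_forestPackage_linear)

variable {F : T4Family}

/-- ★★★ **PROPOSITION 1 [IV] AT PRINT'S (1.74) OBJECT — THE FULL ASSEMBLY WITH THE GAUGE LETTER (σ)_N DISCHARGED BY NAME FROM THE FOREST-PACKAGE PRODUCER.**  (v) (p639701) with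
its binder `hσN` REPLACED by the per-instance inputs of `B15Prop1GaugeLetterSocketOfForestPackage.hσN_of_forestPackage_linear`: the rooted tower-forest package, budgets, the
`N i`-geometry, the reference guard and moduli, the graded root-free plaquette letter at the minimiser and the root-transporter letter (both linear in the guard).  Conclusion VERBATIM
(v)'s.  Proof: (v) with `hσN := fun i => hσN_of_forestPackage_linear …`.
[cite: Balaban1989LargeFieldI, (1.74) p.192, Prop. 1 (1.77)–(1.78) p.194 (incl. «for ε > 0 sufficiently small» and the last clause), (1.79) p.195; Balaban1989LargeFieldII, p.357,
(1.7)–(1.9) p.358, (1.12)–(1.13) p.359; Balaban1985Variational, (2)–(4) p.278, Thm 1 (8) p.279, (16)–(18) p.280, Prop. 9 (190) p.309; Balaban1988Convergent, (2.2) p.255, (2.11)–(2.14) pp.256–257] -/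
theorem exists_domain_prop1Printed_lfVarOn_std_su2_box_intrinsic_analytic_atZSeqCoPRecord_ofThm1TorusClass_ofMinimiserFamily_ofForestPackageAtTolerance_ofChartLetterN_ofCoercive
    (ν : Node00.Stage7Numerics) (Kt : ℕ) (hd3 : 3 ≤ (F.P Kt).d) (h0 : 0 < (F.P Kt).d) {ι : Type} [Finite ι]
    (Z Λ : ι → Set (Site (F.P Kt) 0)) (k : ι → ℕ) (M : ι → ℝ) (hk0 : ∀ i, 0 < k i) (hk : ∀ i, k i ≤ (F.P Kt).m + (F.P Kt).K)
    -- the REFERENCE guard per instance (the guard of the row is chosen below it, inside)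
    (eR₀ : ι → ℝ) (heR₀ : ∀ i, 0 < eR₀ i)
    (T : ∀ i, Finset (PBond (F.P Kt) (k i)))
    (lo hi : ι → Fin (F.P Kt).d → ℤ) (n : ι → ℕ) (hn : ∀ i κ, hi i κ ≤ lo i κ + n i) (hN : ∀ i, n i + 2 < (F.P Kt).sitesPerDir (k i))
    (hbox : ∀ i, pts (k i) (Λ i) = (castSite '' Set.Icc (lo i) (hi i) : Set (Site (F.P Kt) (k i))))
    (hZ : ∀ i, (boxPlaqs (lo i - 1) (hi i + 1) : Set (Plaq (F.P Kt) (k i))) ⊆ plaqsInside (pts (k i) (Z i)))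
    (hTG0 : ∀ i, T i = (box (fun κ => (hi i κ - lo i κ + 1).toNat) (lo i)).image fun x =>
      (⟨castSite (x - unitVec ⟨0, h0⟩), ⟨0, h0⟩⟩ : PBond (F.P Kt) (k i)))
    (hN5 : ∀ i κ, ((hi i κ - lo i κ + 1).toNat : ℤ) + 5 < (F.P Kt).sitesPerDir (k i))
    (ext : ∀ i, GaugeField (F.P Kt) (k i) SU2 → GaugeField (F.P Kt) (k i) SU2)
    (hext : ∀ i Vk, ext i Vk = extend (pts (k i) (Λ i)) (shellGauge Vk (lo i) (hi i)) Vk)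
    (hlohi : ∀ i, lo i ≤ hi i)
    -- the REGION parallelepipeds of the normalisation (the datum tolerances `ρn i` are chosen inside, linear in the guard)
    (LO HI : ι → Fin (F.P Kt).d → ℤ) (hLO : ∀ i, LO i ≤ lo i - 1) (hHI : ∀ i, hi i + 1 ≤ HI i) (n' : ι → ℕ) (hn' : ∀ i κ, HI i κ ≤ LO i κ + n' i)
    (hn'N : ∀ i, n' i < (F.P Kt).sitesPerDir (k i)) (hR' : ∀ i, (boxPlaqs (LO i) (HI i) : Set (Plaq (F.P Kt) (k i))) ⊆ plaqsInside (pts (k i) (Z i)))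
    {bx : ℝ} (hbx : 0 < bx)
    (hbxM : ∀ i, 12 * ((F.P Kt).d : ℝ) * ((n i : ℝ) + 2) ^ 2 ≤ bx * (M i) ^ 2)
    {R 𝓐₀ : ι → ℝ} (hM : ∀ i, 1 ≤ (M i)) (hR : ∀ i, 0 < R i)
    -- (J0′), R-EXPLICIT, AT THE REFERENCE GUARD: per instance one radius and one bound for every base field of the strict guard `eR₀ i`
    (hMin : ∀ i Vk, PlaqSmallOn (plaqsInside (pts (k i) (Z i ∩ (Λ i)ᶜ))) (eR₀ i) Vk →
      ∃ Ũ : VecField (F.P Kt) (k i) (EuclideanSpace ℂ (Fin 3)) × VecField (F.P Kt) (k i) (EuclideanSpace ℂ (Fin 3)) →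
          PBond (F.P Kt) 0 → Matrix (Fin 2) (Fin 2) ℂ,
        (∀ b a c, DifferentiableOn ℂ (fun z => Ũ z b a c) (ball 0 (R i))) ∧
        (∀ z ∈ ball (0 : VecField (F.P Kt) (k i) (EuclideanSpace ℂ (Fin 3)) × VecField (F.P Kt) (k i) (EuclideanSpace ℂ (Fin 3))) (R i),
          ∀ b a c, ‖Ũ z b a c‖ ≤ 𝓐₀ i) ∧
        ∀ p B' : VecField (F.P Kt) (k i) E3, ‖p‖ < R i → ‖B'‖ < R i → ∃ U' : GaugeField (F.P Kt) 0 SU2,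
          (∀ b, Ũ (cplxVec p, cplxVec B') b = ((U' b : SU2) : Matrix (Fin 2) (Fin 2) ℂ)) ∧
            IsMinimizer (Node00.avOfRecord F 2 Kt) (Node00.regMSCoPOfRecord F 2 ν Kt (k i) (maxDomT ν.M₁ (Z i))) (Bj ν.M₁ (Z i) (k i))
              (avgFamily (Node00.avOfRecord F 2 Kt) (qsstarGIter0 (k i) (expMul su2Chart B' (ext i (expMul su2Chart p Vk))))) U')
    (h𝓐₀ : ∀ i, 0 ≤ 𝓐₀ i)
    -- LOCATED-CIN (R-a): per instance the bond neighbourhood on which the `inputs` near-flatness is delivered ∕ asked, with dag-n12-w4's ONE geometry letter on it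
    (N : ι → Set (PBond (F.P Kt) 0)) (hNpos : ∀ i, B14.Eq12InteriorLocality.inputsPos (Bj ν.M₁ (Z i) (k i) : DetSet (F.P Kt)) ⊆ N i)
    -- (σ)_N DISCHARGED BY NAME from dag-n12-w6 g2's forest-package producer: per instance the rooted tower-forest package of `𝐁_k(Z_i)` (dag-n12-w3), budgets,
    -- the `N i`-geometry, and the two DISPLAYED letters LINEAR in the guard (graded root-free plaquette letter at the minimiser; root-transporter letter)
    (path : ι → Site (F.P Kt) 0 → List (LStep (F.P Kt) 0)) (root : ι → Site (F.P Kt) 0 → Site (F.P Kt) 0)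
    (hF2 : ∀ i, ∀ j, j ≤ (k i) → ∀ c ∈ bondsOf (Bj ν.M₁ (Z i) (k i) j), (path i) (embIter j c.src) = [] ∧ (path i) (embIter j c.tgt) = [])
    (hwalk : ∀ i, ∀ x, (path i) x = walk ((root i) x) (((path i) x).map fun s => (s.bond.dir, s.fwd)) ∧
      walkEnd ((root i) x) (((path i) x).map fun s => (s.bond.dir, s.fwd)) = x)
    (hpkg : ∀ i, ∀ (z : Site (F.P Kt) 0) (j : ℕ), j ≤ (k i) →
      embIter j (iterBlockOf j z) ∈ {z : Site (F.P Kt) 0 | ∃ j, j ≤ (k i) ∧ ∃ c ∈ bondsOf ((Bj ν.M₁ (Z i) (k i) : DetSet (F.P Kt)) j), (z = embIter j c.src ∨ z = embIter j c.tgt)} →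
      (∀ s ∈ (path i) z, iterBlockOf j s.bond.src = iterBlockOf j z ∧ iterBlockOf j s.bond.tgt = iterBlockOf j z) ∧
      ((path i) z).length ≤ ∑ i ∈ Finset.range (j + 1), ((F.P Kt).d * (((F.P Kt).L ^ i - 1) / 2) + 1) ∧
      (∀ ν', netDisp (((path i) z).map fun s => (s.bond.dir, s.fwd)) ν' = ((z ν').val : ℤ) - (((root i) z ν').val : ℤ)) ∧
      iterBlockOf j ((root i) z) = iterBlockOf j z)
    (hcov : ∀ i, ∀ z : Site (F.P Kt) 0, ∃ J, J ≤ (k i) ∧ iterBlockOf J z ∈ (Bj ν.M₁ (Z i) (k i) : DetSet (F.P Kt)) J)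
    -- budgets: per-site word bounds, per-bond transporter bounds, uniform caps (no wrapping)
    (ℓs : ι → Site (F.P Kt) 0 → ℕ) (hℓs : ∀ i, ∀ x ∈ maxDomT ν.M₁ (Z i) 1, (path i x).length ≤ ℓs i x)
    (ℓb : ι → PBond (F.P Kt) 0 → ℕ) (ℓ ℓT : ι → ℕ) (hcapS : ∀ i, ∀ x ∈ maxDomT ν.M₁ (Z i) 1, ℓs i x ≤ ℓ i)
    (hcapB : ∀ i, ∀ b : PBond (F.P Kt) 0, b.src ∈ maxDomT ν.M₁ (Z i) 1 → b.tgt ∈ maxDomT ν.M₁ (Z i) 1 → ℓb i b ≤ ℓT i) (hNcap : ∀ i, 2 * ℓ i + 1 + ℓT i < (F.P Kt).sitesPerDir 0)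
    -- geometry of the neighbourhood `N i` ((gN1) at the region box, (gN2))
    (hGN : ∀ i, ∀ b ∈ (N i), (b.src ∉ maxDomT ν.M₁ (Z i) 1 ∨ b.tgt ∉ maxDomT ν.M₁ (Z i) 1) → blockIter (k i) b.tgt ≠ blockIter (k i) b.src →
      (⟨blockIter (k i) b.src, b.dir⟩ : PBond (F.P Kt) (k i)) ∈ (boxBonds (LO i) (HI i) : Set (PBond (F.P Kt) (k i))))
    (hN1 : ∀ i, ∀ p : Plaq (F.P Kt) 0, ((⟨p.src, p.μ⟩ : PBond (F.P Kt) 0) ∈ {b : PBond (F.P Kt) 0 | b.src ∈ maxDomT ν.M₁ (Z i) 1} ∨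
        (⟨p.src.shift p.μ, p.ν⟩ : PBond (F.P Kt) 0) ∈ {b : PBond (F.P Kt) 0 | b.src ∈ maxDomT ν.M₁ (Z i) 1} ∨
        (⟨p.src.shift p.ν, p.μ⟩ : PBond (F.P Kt) 0) ∈ {b : PBond (F.P Kt) 0 | b.src ∈ maxDomT ν.M₁ (Z i) 1} ∨
        (⟨p.src, p.ν⟩ : PBond (F.P Kt) 0) ∈ {b : PBond (F.P Kt) 0 | b.src ∈ maxDomT ν.M₁ (Z i) 1}) →
      (⟨p.src, p.μ⟩ : PBond (F.P Kt) 0) ∈ (N i) ∧ (⟨p.src.shift p.μ, p.ν⟩ : PBond (F.P Kt) 0) ∈ (N i) ∧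
        (⟨p.src.shift p.ν, p.μ⟩ : PBond (F.P Kt) 0) ∈ (N i) ∧ (⟨p.src, p.ν⟩ : PBond (F.P Kt) 0) ∈ (N i))
    -- the reference guard and the LINEAR budgets of the two displayed letters
    (e₀ cP cT cG : ι → ℝ) (he₀ : ∀ i, 0 < e₀ i) (hcP : ∀ i, 0 ≤ cP i) (hcT : ∀ i, 0 ≤ cT i) (hcG : ∀ i, 0 ≤ cG i)
    -- DISPLAYED, LINEAR IN THE GUARD: the graded root-free plaquette letter ((1.7) ∕ [15] Thm 1 at the minimiser) on `S`, for every guarded base field and every minimiser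
    (S : ι → Set (Plaq (F.P Kt) 0))
    (hP : ∀ i, ∀ e : ℝ, 0 < e → e ≤ (e₀ i) → ∀ (Vk : GaugeField (F.P Kt) (k i) SU2), PlaqSmallOn (plaqsInside (pts (k i) ((Z i) ∩ (Λ i)ᶜ))) e Vk →
      (∀ b ∈ (boxBonds (LO i) (HI i) : Set (PBond (F.P Kt) (k i))), dist1 ((ext i) Vk b) ≤
        (((F.P Kt).d : ℝ) * (n' i) + 1) * ((((F.P Kt).d - 1 : ℕ) : ℝ) * (n' i) * ((12 * (F.P Kt).d * ((n i) + 2) ^ 2 + 1) * e) + 3 * (F.P Kt).d * ((n i) + 2) ^ 2 * e)) →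
      ∀ U₀ : GaugeField (F.P Kt) 0 SU2,
        IsMinimizer (Node00.avOfRecord F 2 Kt) (Node00.regMSCoPOfRecord F 2 ν Kt (k i) (maxDomT ν.M₁ (Z i))) (Bj ν.M₁ (Z i) (k i))
          (avgFamily (Node00.avOfRecord F 2 Kt) (qsstarGIter0 (k i) ((ext i) Vk))) U₀ →
        PlaqSmallOn (S i) ((cP i) * e) U₀)
    (hSΩ : ∀ i, ∀ b : PBond (F.P Kt) 0, b.src ∈ maxDomT ν.M₁ (Z i) 1 → b.tgt ∈ maxDomT ν.M₁ (Z i) 1 →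
      (boxPlaqs (fun κ => ((b.src κ).val : ℤ) - (((2 * max ((ℓs i) b.src) ((ℓs i) b.tgt) + 1 + (ℓb i) b) + (ℓs i) b.src : ℕ) : ℤ))
          (fun κ => ((b.src κ).val : ℤ) + (((2 * max ((ℓs i) b.src) ((ℓs i) b.tgt) + 1 + (ℓb i) b) + (ℓs i) b.src : ℕ) : ℤ) + 2) : Set (Plaq (F.P Kt) 0)) ⊆ (S i))
    -- DISPLAYED, LINEAR IN THE GUARD: the root-transporter letter ([15] (16)–(18) between the points of `𝔅_k`), for every guarded base field and every minimiser
    (hT : ∀ i, ∀ e : ℝ, 0 < e → e ≤ (e₀ i) → ∀ (Vk : GaugeField (F.P Kt) (k i) SU2), PlaqSmallOn (plaqsInside (pts (k i) ((Z i) ∩ (Λ i)ᶜ))) e Vk →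
      (∀ b ∈ (boxBonds (LO i) (HI i) : Set (PBond (F.P Kt) (k i))), dist1 ((ext i) Vk b) ≤
        (((F.P Kt).d : ℝ) * (n' i) + 1) * ((((F.P Kt).d - 1 : ℕ) : ℝ) * (n' i) * ((12 * (F.P Kt).d * ((n i) + 2) ^ 2 + 1) * e) + 3 * (F.P Kt).d * ((n i) + 2) ^ 2 * e)) →
      ∀ U₀ : GaugeField (F.P Kt) 0 SU2,
        IsMinimizer (Node00.avOfRecord F 2 Kt) (Node00.regMSCoPOfRecord F 2 ν Kt (k i) (maxDomT ν.M₁ (Z i))) (Bj ν.M₁ (Z i) (k i))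
          (avgFamily (Node00.avOfRecord F 2 Kt) (qsstarGIter0 (k i) ((ext i) Vk))) U₀ →
        ∀ b : PBond (F.P Kt) 0, b.src ∈ maxDomT ν.M₁ (Z i) 1 → b.tgt ∈ maxDomT ν.M₁ (Z i) 1 → (root i) b.src ≠ (root i) b.tgt →
          ∃ (Ωw : List (Letter (F.P Kt).d)) (g : SU2), walkEnd ((root i) b.src) Ωw = (root i) b.tgt ∧ Ωw.length ≤ (ℓb i) b ∧
            dist1 (holAt U₀ (walk ((root i) b.src) Ωw) * g⁻¹) ≤ (cT i) * e ∧ dist1 g ≤ (cG i) * e)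
    -- dag-n12-w4's GEOMETRY letter of the chart file (its chart constants and the localised chart body are supplied INSIDE, from `chartLetter_of_letters_N`)
    (hΩw : ∀ i, ∀ (ν' : Fin (F.P Kt).d), ∀ z ∈ box (fun κ => (hi i κ - lo i κ + 1).toNat + 3) (fun κ => lo i κ - 2),
      (castSite z : Site (F.P Kt) (k i)) ∈ pts (k i) (maxDomT ν.M₁ (Z i) (k i)) ∧
        (castSite z : Site (F.P Kt) (k i)).shift ⟨0, h0⟩ ∈ pts (k i) (maxDomT ν.M₁ (Z i) (k i)) ∧
        (castSite z : Site (F.P Kt) (k i)).shift ν' ∈ pts (k i) (maxDomT ν.M₁ (Z i) (k i)))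
    (hfar : ∀ i (b : PBond (F.P Kt) 0), b.src ∉ maxDomT ν.M₁ (Z i) 1 →
      (⟨blockIter (k i) b.src, b.dir⟩ : PBond (F.P Kt) (k i)) ∉ bondsOf (pts (k i) (Λ i)))
    (hZblk : ∀ i, IsBlockUnion (k i) (Z i))
    (hM2 : 2 ≤ ν.M₁) (hdiv : ∀ i, side (F.P Kt).L ν.M₁ (k i) ∣ (F.P Kt).sitesPerDir 0)
    {B₃ a₀ a₁' : ℝ} (hB₃ : 0 ≤ B₃) (ha₁' : 0 < a₁') (hεreg : 0 < ν.εreg) (ha₀ : ν.εreg ≤ a₀)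
    (h15T : ∀ (k' : ℕ), k' ≤ (F.P Kt).m + (F.P Kt).K → side (F.P Kt).L ν.M₁ k' ∣ (F.P Kt).sitesPerDir 0 →
      ∀ (s : B14.Eq218Concrete.Seq (fun n : ℕ => Node00.unionsOfCubes (F.P Kt) (side (F.P Kt).L ν.M₁ n)) k'),
      Node00.Sect2.SeqSeparated ν.M₁ s → 0 < ν.M₁ →
      ∀ (ε₀ : ℝ) (δ : ℕ → ℝ), (∀ j, j ≤ k' → 0 < δ j ∧ δ j ≤ a₁' ∧ B₃ * δ j ≤ ε₀) → (∀ j, j < k' → δ j ≤ 2 * δ (j + 1)) →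
      (∀ j, j < k' → δ (j + 1) ≤ 2 * δ j) → ε₀ ≤ a₀ →
      ∀ W : MSField (F.P Kt) SU2,
        Node00.Sect2.DataSmall7PTop (Node00.avOfRecord F 2 Kt) s.Ω (Node00.suppDomOfRecord F ν Kt s.Ω) k' δ W →
        ∀ U₀ : GaugeField (F.P Kt) 0 SU2, IsMinimizer (Node00.avOfRecord F 2 Kt)
            {U | (∀ j, j ≤ k' → PlaqSmallOn (Node00.Sect2.omegaPlaqsTop s.Ω (Node00.suppDomOfRecord F ν Kt s.Ω) j)
                (ε₀ * (F.P Kt).eta j ^ 2) U) ∧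
              Node00.Sect2.CoDivClassOnTop s.Ω (Node00.suppDomOfRecord F ν Kt s.Ω) k' ε₀ U}
            (genSet s.Ω k') W U₀ →
          (∀ j, j ≤ k' → PlaqSmallOn (Node00.Sect2.omegaPlaqsTop s.Ω (Node00.suppDomOfRecord F ν Kt s.Ω) j)
              (B₃ * δ j * (F.P Kt).eta j ^ 2) U₀) ∧
            ∀ j, j ≤ k' → Node00.Sect2.CoDivSmallOn (Node00.Sect2.omegaBondsTop s.Ω (Node00.suppDomOfRecord F ν Kt s.Ω) j)
              (B₃ * δ j * (F.P Kt).eta j ^ 3) U₀)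
    : ∃ a₁ : ι → ℝ, (∀ i, 0 < a₁ i) ∧
      B15.Prop1Printed (lfVarOn su2Chart fun i =>
        InstOn.std (Node00.bgMSCoPOfRecord F 2 ν Kt (k i) (maxDomT ν.M₁ (Z i))) ν.M₁ (Z i) (Λ i) (k i) (M i) (a₁ i)
          (anExt (pts (k i) (Λ i)) (T i)
            (fun177std (Node00.bgMSCoPOfRecord F 2 ν Kt (k i) (maxDomT ν.M₁ (Z i))) ν.M₁ (Z i) (k i)) (ext i)
            (min (1 / 2) (min (R i / 8) ((12 * ((F.P Kt).d : ℝ)) ^ 2 / (10 * bx ^ 2) / (M i) ^ 5 * (R i / 2) ^ 2 /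
              (48 * (4 * ((Fintype.card (Plaq (F.P Kt) 0) : ℝ) * (1 + 8 * 𝓐₀ i ^ 4)) / R i + 1)))))))
    := by
  refine N12Prop1AssembledOfGaugeLetterAtToleranceLocOfChartLetterN.exists_domain_prop1Printed_lfVarOn_std_su2_box_intrinsic_analytic_atZSeqCoPRecord_ofThm1TorusClass_ofMinimiserFamily_ofGaugeLetterNAtTolerance_ofChartLetterN_ofCoercive
    ν Kt hd3 h0 Z Λ k M hk0 hk eR₀ heR₀ T lo hi n hn hN hbox hZ hTG0 hN5 ext hext hlohi LO HI hLO hHI n' hn' hn'N hR' hbx hbxM hM hR hMin h𝓐₀ N hNpos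
    (fun i => ?_) hΩw hfar hZblk hM2 hdiv hB₃ ha₁' hεreg ha₀ h15T
  exact hσN_of_forestPackage_linear ν Kt (hk0 i) (hk i) (Z i) (path i) (root i) (hF2 i) (hwalk i) (hpkg i) (hcov i) (ℓs i) (hℓs i) (ℓb i) (hcapS i) (hcapB i) (hNcap i)
    (Λ i) (ext i) (LO i) (HI i) (n i) (n' i) (N i) (hGN i) (hN1 i) (he₀ i) (hcP i) (hcT i) (hcG i) (hP i) (hSΩ i) (hT i)

end Summit.QuantumFields.YangMills.BalabanUVNodes.N12Prop1AssembledOfForestPackageLocOfChartLetterN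

end
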